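import Summits.HodgeConjecture.HodgeConjecture.Theorems.K2E1BLConstantTermProjectionU2      -- ★ p858855 FILE A: §1 toolkit, §2 generic identification, `borelConstantTerm_indicator_preimage`
import Summits.HodgeConjecture.HodgeConjecture.Theorems.K2E1BLFibreAverageInvarianceU       -- ★ p858957 (K2E1-p08 g6): `integral_zFun_borelConstantTerm_eq_of_unfolding` (the letter `hdis'` as a theorem)
import HarnessLib

/-!
# `cnst_k (toHN φ) = toHN (φ_B)` for BOREL `φ` — FILE A's identification with the measurability threaded through the
# disintegration letter («BL-P2b-A′», byte reconciliation), and its discharge by K2E1-p08's unfolding theorem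

(Bernstein–Lapid, arXiv:1911.02342 = J. AMS 37 (2024), §4 Claim 4 p. 10; Mœglin–Waldspurger (1995), I.2.6.)

Topic `NumberTheory/Automorphic`; crux H413, cell `pub/hodgecm-mathlib`, campaign «EIS-R7-BL-SPH-2»; dealer K2E1-plan (g5) 2026-09-04T09:25:16Z
BYTE-RECONCILIATION: FILE A ★ `K2E1BLConstantTermProjectionU2` states its disintegration letter `hdis` for ALL `Φ : G(𝔸) → ℂ`, while the theorem that
pays it, ★ `K2E1BLFibreAverageInvarianceU.integral_zFun_borelConstantTerm_eq_of_unfolding` (K2E1-p08), carries `(hΦm : Measurable Φ)`. This file restates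
FILE A's §3–§4 with the WEAKER letter
`hdis' : ∀ Φ, Measurable Φ → (∀ b ∈ B(F), ∀ g, Φ (b g) = Φ g) → Integrable (zFun Φ) μw → Integrable (zFun Φ_B) μw → ∫ zFun Φ_B ∂μw = ∫ zFun Φ ∂μw`
and a Borel `φ` (same proofs: the saturated cut-offs `𝟙_{π⁻¹s}·φ` of a Borel `φ` are Borel, `π` being continuous), and then DISCHARGES `hdis'` by the ★ unfolding
theorem under its structural letters (`νG`, `νN`, `hconj`, `h𝓕`, `h𝓕₀`, `h𝓕top`, `hβ`, `hμZ`) — the consumer-ready one-call forms. THEOREMS ONLY (no definition,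
no named fact, no instance, no notation, no `sorry`); every rank `N`.

* §1 `measurable_toBorelQuotient`, `measurable_indicator_preimage`, **`setIntegral_zFun_borelConstantTerm_eq'`**, **`cnstN_toHN_eq_toHN_borelConstantTerm'`** ((i) under `hdis'`),
  **`toHN_mem_HNcusp_iff_ae'`**, `toHN_mem_HNcusp_of_forall_eq_zero'` ((iii) under `hdis'`).
* §2 **`cnstN_toHN_eq_toHN_borelConstantTerm_of_unfolding`**, **`toHN_mem_HNcusp_iff_ae_of_unfolding`**, `toHN_mem_HNcusp_of_forall_eq_zero_of_unfolding` — `hdis'` PAID by ★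
  `integral_zFun_borelConstantTerm_eq_of_unfolding` (at `N = 2` pass `hconj := fun _ hb₀ => map_conj_toAdelic_eq_self_two hc hc1 νN hb₀`).
HONEST LABEL: HC_CM is proved only modulo the 7 printed citations (2 remaining named inputs: hLiu418 = `stmt-HodgeConjecture-24832`,
h413 = `stmt-HodgeConjecture-24833`) until rung 0 closes; count-neutral helper, closes no socket.

## References
* J. Bernstein, E. Lapid, *On the meromorphic continuation of Eisenstein series*, arXiv:1911.02342, J. AMS 37 (2024): §4 Claim 4 (p. 10) [BernsteinLapid2019].
* C. Mœglin, J.-L. Waldspurger, *Spectral Decomposition and Eisenstein Series*, CUP (1995): I.2.6 [MoeglinWaldspurger1995].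
-/

set_option autoImplicit false
set_option linter.dupNamespace false

noncomputable section

open MeasureTheory Measure NumberField IsDedekindDomain Set Filter Topology
open scoped ENNReal NNReal
open Literature.MeasureTheory.Group Literature.NumberTheory.Automorphic Literature.NumberTheory.Automorphic.UnitaryGroup AdelicGroupData
open Summit.HodgeConjecture.HodgeConjecture.Cruxes.H413.K2E1BLBorelSpacesU2Defs
open Summit.HodgeConjecture.HodgeConjecture.Cruxes.H413.K2E1BLConstantTermProjectionU2
open Summit.HodgeConjecture.HodgeConjecture.Cruxes.H413.K2E1BLFibreAverageInvarianceU

namespace Summit.HodgeConjecture.HodgeConjecture.Cruxes.H413.K2E1BLConstantTermProjectionMeasurableU2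

variable {F E : Type} [Field F] [NumberField F] [Field E] [NumberField E] [Algebra F E] {c : E ≃ₐ[F] E} {N : ℕ} [NeZero N]
variable [MeasurableSpace (quasiSplit F E c N).Adelic] [BorelSpace (quasiSplit F E c N).Adelic]

/-! ## §1 (i) and (iii) of FILE A for Borel `φ` under the measurable disintegration letter `hdis'` -/

omit [NeZero N] in
/-- `π : G(𝔸) → Z` is Borel measurable (continuous). [cite: BernsteinLapid2019, §4 p. 10] -/
theorem measurable_toBorelQuotient : Measurable (toBorelQuotient F E c N) :=
  (continuous_toBorelQuotient F E c N).measurable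

omit [NeZero N] in
/-- The saturated cut-off `𝟙_{π⁻¹s}·φ` of a Borel `φ` along an `mN`-set `s` is Borel. [cite: BernsteinLapid2019, §4 Claim 4 p. 10] -/
theorem measurable_indicator_preimage {s : Set (borelQuotient F E c N)} (hs : MeasurableSet[invariantSigma F E c N] s)
    {φ : (quasiSplit F E c N).Adelic → ℂ} (hφm : Measurable φ) :
    Measurable ((toBorelQuotient F E c N ⁻¹' s).indicator φ) :=
  hφm.indicator (measurable_toBorelQuotient (invariantSigma_le F E c N s hs))

section Disintegration

variable [MeasurableSpace (adelicUnipotent F E c N)]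
variable (ν : Measure (adelicUnipotent F E c N)) (𝓕 : Set (adelicUnipotent F E c N)) (k : ℕ) (c₁ : ℝ≥0)
  (μZ : Measure (borelQuotient F E c N))

/-- **The measurable disintegration letter gives the set integrals** (FILE A `setIntegral_zFun_borelConstantTerm_eq` with `Measurable Φ` threaded): `hdis'`
applied to the Borel cut-off `Φ = 𝟙_{π⁻¹s}·φ` yields `∫_s zFun φ_B = ∫_s zFun φ` on every `mN`-set `s`. [cite: BernsteinLapid2019, §4 Claim 4 p. 10]
[cite: MoeglinWaldspurger1995, I.2.6] -/
theorem setIntegral_zFun_borelConstantTerm_eq'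
    (hdis' : ∀ Φ : (quasiSplit F E c N).Adelic → ℂ, Measurable Φ → (∀ b ∈ ratBorelSubgroup F E c N, ∀ g, Φ (b * g) = Φ g) →
      Integrable (zFun F E c N Φ) (weightedTruncMeasure F E c N k c₁ μZ) →
      Integrable (zFun F E c N (borelConstantTerm ν 𝓕 Φ)) (weightedTruncMeasure F E c N k c₁ μZ) →
        ∫ z, zFun F E c N (borelConstantTerm ν 𝓕 Φ) z ∂weightedTruncMeasure F E c N k c₁ μZ =
          ∫ z, zFun F E c N Φ z ∂weightedTruncMeasure F E c N k c₁ μZ)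
    {φ : (quasiSplit F E c N).Adelic → ℂ} (hφm : Measurable φ) (hφB : ∀ b ∈ ratBorelSubgroup F E c N, ∀ g, φ (b * g) = φ g)
    (hφ1 : Integrable (zFun F E c N φ) (weightedTruncMeasure F E c N k c₁ μZ))
    (hψ1 : Integrable (zFun F E c N (borelConstantTerm ν 𝓕 φ)) (weightedTruncMeasure F E c N k c₁ μZ))
    {s : Set (borelQuotient F E c N)} (hs : MeasurableSet[invariantSigma F E c N] s) :
    ∫ x in s, zFun F E c N (borelConstantTerm ν 𝓕 φ) x ∂weightedTruncMeasure F E c N k c₁ μZ =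
      ∫ x in s, zFun F E c N φ x ∂weightedTruncMeasure F E c N k c₁ μZ := by
  have hs' : MeasurableSet s := invariantSigma_le F E c N s hs
  have hΦB : ∀ b ∈ ratBorelSubgroup F E c N, ∀ g,
      (toBorelQuotient F E c N ⁻¹' s).indicator φ (b * g) = (toBorelQuotient F E c N ⁻¹' s).indicator φ g := by
    intro b hb g
    have hmem : b * g ∈ toBorelQuotient F E c N ⁻¹' s ↔ g ∈ toBorelQuotient F E c N ⁻¹' s :=
      toBorelQuotient_mul_mem_iff hs (ratBorelSubgroup_le_adelicUnipBorelSubgroup F E c N hb) g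
    by_cases h : g ∈ toBorelQuotient F E c N ⁻¹' s
    · rw [indicator_of_mem h, indicator_of_mem (hmem.2 h), hφB b hb g]
    · rw [indicator_of_notMem h, indicator_of_notMem (fun h' => h (hmem.1 h'))]
  have h1 : zFun F E c N ((toBorelQuotient F E c N ⁻¹' s).indicator φ) = s.indicator (zFun F E c N φ) :=
    zFun_indicator_preimage s φ
  have h2 : zFun F E c N (borelConstantTerm ν 𝓕 ((toBorelQuotient F E c N ⁻¹' s).indicator φ)) =
      s.indicator (zFun F E c N (borelConstantTerm ν 𝓕 φ)) := by
    rw [borelConstantTerm_indicator_preimage ν 𝓕 hs φ, zFun_indicator_preimage]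
  have h := hdis' _ (measurable_indicator_preimage hs hφm) hΦB (by rw [h1]; exact hφ1.indicator hs') (by rw [h2]; exact hψ1.indicator hs')
  rw [h1, h2, integral_indicator hs', integral_indicator hs'] at h
  exact h

variable [BorelSpace (adelicUnipotent F E c N)]

/-- **(i) `cnst_k (toHN φ) = toHN (φ_B)` for BOREL `φ` under the measurable letter `hdis'`** (FILE A `cnstN_toHN_eq_toHN_borelConstantTerm`, binder order
`(hdis') (hφm) (hφB) (hφ2) (hψ2) (hψc)`). [cite: BernsteinLapid2019, §4 Claim 4 p. 10] [cite: MoeglinWaldspurger1995, I.2.6] -/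
theorem cnstN_toHN_eq_toHN_borelConstantTerm' [ν.IsHaarMeasure] [ν.IsMulRightInvariant]
    (h𝓕 : IsFundamentalDomain (rationalUnipotent F E c N) 𝓕 ν) [IsFiniteMeasure (weightedTruncMeasure F E c N k c₁ μZ)]
    (hdis' : ∀ Φ : (quasiSplit F E c N).Adelic → ℂ, Measurable Φ → (∀ b ∈ ratBorelSubgroup F E c N, ∀ g, Φ (b * g) = Φ g) →
      Integrable (zFun F E c N Φ) (weightedTruncMeasure F E c N k c₁ μZ) →
      Integrable (zFun F E c N (borelConstantTerm ν 𝓕 Φ)) (weightedTruncMeasure F E c N k c₁ μZ) →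
        ∫ z, zFun F E c N (borelConstantTerm ν 𝓕 Φ) z ∂weightedTruncMeasure F E c N k c₁ μZ =
          ∫ z, zFun F E c N Φ z ∂weightedTruncMeasure F E c N k c₁ μZ)
    {φ : (quasiSplit F E c N).Adelic → ℂ} (hφm : Measurable φ) (hφB : ∀ b ∈ ratBorelSubgroup F E c N, ∀ g, φ (b * g) = φ g)
    (hφ2 : MemLp (zFun F E c N φ) 2 (weightedTruncMeasure F E c N k c₁ μZ))
    (hψ2 : MemLp (zFun F E c N (borelConstantTerm ν 𝓕 φ)) 2 (weightedTruncMeasure F E c N k c₁ μZ))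
    (hψc : Continuous (borelConstantTerm ν 𝓕 φ)) :
    cnstN F E c N k c₁ μZ (toHN F E c N k c₁ μZ φ hφ2) = toHN F E c N k c₁ μZ (borelConstantTerm ν 𝓕 φ) hψ2 :=
  cnstN_toHN_eq_toHN_of_forall_setIntegral_eq k c₁ μZ hφ2 hψ2
    (aestronglyMeasurable_invariantSigma_zFun (borelConstantTerm_adelicUnipBorel_mul ν h𝓕 hφB) hψc _)
    (fun _ hs _ => setIntegral_zFun_borelConstantTerm_eq' ν 𝓕 k c₁ μZ hdis' hφm hφB (hφ2.integrable one_le_two)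
      (hψ2.integrable one_le_two) hs)

/-- **(iii) KERNEL READING for Borel `φ` under `hdis'`**: `toHN φ ∈ HNcusp ↔ zFun φ_B = 0` `μw`-a.e. (FILE A `toHN_mem_HNcusp_iff_ae`).
[cite: BernsteinLapid2019, §4 Claim 5 p. 10] -/
theorem toHN_mem_HNcusp_iff_ae' [ν.IsHaarMeasure] [ν.IsMulRightInvariant]
    (h𝓕 : IsFundamentalDomain (rationalUnipotent F E c N) 𝓕 ν) [IsFiniteMeasure (weightedTruncMeasure F E c N k c₁ μZ)]
    (hdis' : ∀ Φ : (quasiSplit F E c N).Adelic → ℂ, Measurable Φ → (∀ b ∈ ratBorelSubgroup F E c N, ∀ g, Φ (b * g) = Φ g) →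
      Integrable (zFun F E c N Φ) (weightedTruncMeasure F E c N k c₁ μZ) →
      Integrable (zFun F E c N (borelConstantTerm ν 𝓕 Φ)) (weightedTruncMeasure F E c N k c₁ μZ) →
        ∫ z, zFun F E c N (borelConstantTerm ν 𝓕 Φ) z ∂weightedTruncMeasure F E c N k c₁ μZ =
          ∫ z, zFun F E c N Φ z ∂weightedTruncMeasure F E c N k c₁ μZ)
    {φ : (quasiSplit F E c N).Adelic → ℂ} (hφm : Measurable φ) (hφB : ∀ b ∈ ratBorelSubgroup F E c N, ∀ g, φ (b * g) = φ g)
    (hφ2 : MemLp (zFun F E c N φ) 2 (weightedTruncMeasure F E c N k c₁ μZ))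
    (hψ2 : MemLp (zFun F E c N (borelConstantTerm ν 𝓕 φ)) 2 (weightedTruncMeasure F E c N k c₁ μZ))
    (hψc : Continuous (borelConstantTerm ν 𝓕 φ)) :
    toHN F E c N k c₁ μZ φ hφ2 ∈ HNcusp F E c N k c₁ μZ ↔
      zFun F E c N (borelConstantTerm ν 𝓕 φ) =ᵐ[weightedTruncMeasure F E c N k c₁ μZ] 0 := by
  rw [mem_HNcusp_iff, cnstN_toHN_eq_toHN_borelConstantTerm' ν 𝓕 k c₁ μZ h𝓕 hdis' hφm hφB hφ2 hψ2 hψc, Lp.eq_zero_iff_ae_eq_zero]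
  have h := coeFn_toHN F E c N k c₁ μZ (borelConstantTerm ν 𝓕 φ) hψ2
  exact ⟨fun h0 => h.symm.trans h0, fun h0 => h.trans h0⟩

/-- If `φ_B` vanishes identically above the height `c` then `toHN φ` is cuspidal (Borel `φ`, letter `hdis'`; FILE A `toHN_mem_HNcusp_of_forall_eq_zero`).
[cite: BernsteinLapid2019, §4 Claim 5 p. 10] -/
theorem toHN_mem_HNcusp_of_forall_eq_zero' [ν.IsHaarMeasure] [ν.IsMulRightInvariant]
    (h𝓕 : IsFundamentalDomain (rationalUnipotent F E c N) 𝓕 ν) [IsFiniteMeasure (weightedTruncMeasure F E c N k c₁ μZ)]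
    (hdis' : ∀ Φ : (quasiSplit F E c N).Adelic → ℂ, Measurable Φ → (∀ b ∈ ratBorelSubgroup F E c N, ∀ g, Φ (b * g) = Φ g) →
      Integrable (zFun F E c N Φ) (weightedTruncMeasure F E c N k c₁ μZ) →
      Integrable (zFun F E c N (borelConstantTerm ν 𝓕 Φ)) (weightedTruncMeasure F E c N k c₁ μZ) →
        ∫ z, zFun F E c N (borelConstantTerm ν 𝓕 Φ) z ∂weightedTruncMeasure F E c N k c₁ μZ =
          ∫ z, zFun F E c N Φ z ∂weightedTruncMeasure F E c N k c₁ μZ)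
    {φ : (quasiSplit F E c N).Adelic → ℂ} (hφm : Measurable φ) (hφB : ∀ b ∈ ratBorelSubgroup F E c N, ∀ g, φ (b * g) = φ g)
    (hφ2 : MemLp (zFun F E c N φ) 2 (weightedTruncMeasure F E c N k c₁ μZ)) (hψc : Continuous (borelConstantTerm ν 𝓕 φ))
    (h0 : ∀ g, c₁ < borelHeight g → borelConstantTerm ν 𝓕 φ g = 0) :
    toHN F E c N k c₁ μZ φ hφ2 ∈ HNcusp F E c N k c₁ μZ := by
  have hae : zFun F E c N (borelConstantTerm ν 𝓕 φ) =ᵐ[weightedTruncMeasure F E c N k c₁ μZ] 0 := by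
    have hsub : ∀ᵐ z ∂(μZ.restrict {z | c₁ < borelQuotHeight F E c N z}),
        zFun F E c N (borelConstantTerm ν 𝓕 φ) z = (0 : borelQuotient F E c N → ℂ) z := by
      filter_upwards [ae_restrict_mem (measurableSet_lt measurable_const
        (continuous_borelQuotHeight (F := F) (E := E) (c := c) (N := N)).measurable)] with z hz
      have hout : toBorelQuotient F E c N (Quotient.out (z : Quotient (MulAction.orbitRel (ratBorelSubgroup F E c N) (quasiSplit F E c N).Adelic))) = z :=
        Quotient.out_eq _
      have hH : c₁ < borelHeight (Quotient.out (z : Quotient (MulAction.orbitRel (ratBorelSubgroup F E c N) (quasiSplit F E c N).Adelic))) := by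
        rw [← borelQuotHeight_toBorelQuotient F E c N, hout]; exact hz
      exact h0 _ hH
    exact (withDensity_absolutelyContinuous _ _).ae_le hsub
  have hψ2 : MemLp (zFun F E c N (borelConstantTerm ν 𝓕 φ)) 2 (weightedTruncMeasure F E c N k c₁ μZ) :=
    (MemLp.zero (ε := ℂ)).ae_eq hae.symm
  exact (toHN_mem_HNcusp_iff_ae' ν 𝓕 k c₁ μZ h𝓕 hdis' hφm hφB hφ2 hψ2 hψc).2 hae

end Disintegration

/-! ## §2 The letter `hdis'` PAID: the identification under K2E1-p08's structural letters (`μZ = π_*(β ν_G)`, product-formula conjugation invariance) -/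

section Unfolding

-- `N(𝔸)` carries the SUBTYPE σ-algebra of the Borel σ-algebra of `G(𝔸)` here (the currency of ★ `integral_zFun_borelConstantTerm_eq_of_unfolding`); it is Borel
-- (Mathlib `Subtype.borelSpace`), so §1 applies.
variable (νG : Measure (quasiSplit F E c N).Adelic) [νG.IsHaarMeasure]
  (νN : Measure (adelicUnipotent F E c N)) [νN.IsHaarMeasure] [νN.IsInvInvariant] [νN.IsMulRightInvariant]

/-- **(i) DISCHARGED: `cnst_k (toHN φ) = toHN (φ_B)`** for Borel left-`B(F)`-invariant `φ` with `zFun φ, zFun φ_B ∈ L²(μw)` and `φ_B` continuous, `μw` finite, under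
the STRUCTURAL letters of ★ `integral_zFun_borelConstantTerm_eq_of_unfolding` (Haar `νG` on `G(𝔸)`; Haar `νN` on the unimodular `N(𝔸)` with the product-formula
conjugation invariance `hconj` — ★ `map_conj_toAdelic_eq_self_two ∕ _three` at `N = 2, 3` —; `𝓕` a fundamental domain of `N(F)` of finite non-zero measure; the covering
weight `β` and the unfolding `hμZ : μZ = π_*(β νG)`). [cite: BernsteinLapid2019, §4 Claim 4 p. 10] [cite: MoeglinWaldspurger1995, I.2.6] -/
theorem cnstN_toHN_eq_toHN_borelConstantTerm_of_unfolding
    (hconj : ∀ b₀ (hb₀ : b₀ ∈ borelU (c : E →+* E) ((StdForm.antidiagonal N).over E)),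
      νN.map (fun v : ↥(adelicUnipotent F E c N) => (⟨((quasiSplit F E c N).toAdelic b₀)⁻¹ * (v : (quasiSplit F E c N).Adelic) * (quasiSplit F E c N).toAdelic b₀,
        conj_mem_adelicUnipotent ((K2E1PseudoEisensteinConstantTermU.toAdelic_mem_borelAdelic_iff b₀).2 hb₀) v.2⟩ : ↥(adelicUnipotent F E c N))) = νN)
    {𝓕 : Set ↥(adelicUnipotent F E c N)} (h𝓕 : IsFundamentalDomain ↥(rationalUnipotent F E c N) 𝓕 νN) (h𝓕₀ : νN 𝓕 ≠ 0) (h𝓕top : νN 𝓕 ≠ ∞)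
    {β : (quasiSplit F E c N).Adelic → ℝ≥0∞} (hβ : IsCoveringWeight ↥((arithmeticBorel F E c N).map (quasiSplit F E c N).arithmeticSubgroup.subtype) β)
    {μZ : Measure (borelQuotient F E c N)}
    (hμZ : ∀ f : borelQuotient F E c N → ℝ≥0∞, Measurable f → ∫⁻ z, f z ∂μZ = ∫⁻ g, β g * f (toBorelQuotient F E c N g) ∂νG)
    (k : ℕ) (c₁ : ℝ≥0) [IsFiniteMeasure (weightedTruncMeasure F E c N k c₁ μZ)]
    {φ : (quasiSplit F E c N).Adelic → ℂ} (hφm : Measurable φ) (hφB : ∀ b ∈ ratBorelSubgroup F E c N, ∀ g, φ (b * g) = φ g)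
    (hφ2 : MemLp (zFun F E c N φ) 2 (weightedTruncMeasure F E c N k c₁ μZ))
    (hψ2 : MemLp (zFun F E c N (borelConstantTerm νN 𝓕 φ)) 2 (weightedTruncMeasure F E c N k c₁ μZ))
    (hψc : Continuous (borelConstantTerm νN 𝓕 φ)) :
    cnstN F E c N k c₁ μZ (toHN F E c N k c₁ μZ φ hφ2) = toHN F E c N k c₁ μZ (borelConstantTerm νN 𝓕 φ) hψ2 :=
  cnstN_toHN_eq_toHN_borelConstantTerm' νN 𝓕 k c₁ μZ h𝓕
    (fun _ hΦm hΦB hint hint' => integral_zFun_borelConstantTerm_eq_of_unfolding νG νN hconj h𝓕 h𝓕₀ h𝓕top hβ hμZ k c₁ hΦm hΦB hint hint')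
    hφm hφB hφ2 hψ2 hψc

/-- **(iii) DISCHARGED: `toHN φ ∈ 𝓗_k(Z_c)^cusp ↔ zFun φ_B = 0` `μw`-a.e.**, same letters. [cite: BernsteinLapid2019, §4 Claim 5 p. 10] -/
theorem toHN_mem_HNcusp_iff_ae_of_unfolding
    (hconj : ∀ b₀ (hb₀ : b₀ ∈ borelU (c : E →+* E) ((StdForm.antidiagonal N).over E)),
      νN.map (fun v : ↥(adelicUnipotent F E c N) => (⟨((quasiSplit F E c N).toAdelic b₀)⁻¹ * (v : (quasiSplit F E c N).Adelic) * (quasiSplit F E c N).toAdelic b₀,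
        conj_mem_adelicUnipotent ((K2E1PseudoEisensteinConstantTermU.toAdelic_mem_borelAdelic_iff b₀).2 hb₀) v.2⟩ : ↥(adelicUnipotent F E c N))) = νN)
    {𝓕 : Set ↥(adelicUnipotent F E c N)} (h𝓕 : IsFundamentalDomain ↥(rationalUnipotent F E c N) 𝓕 νN) (h𝓕₀ : νN 𝓕 ≠ 0) (h𝓕top : νN 𝓕 ≠ ∞)
    {β : (quasiSplit F E c N).Adelic → ℝ≥0∞} (hβ : IsCoveringWeight ↥((arithmeticBorel F E c N).map (quasiSplit F E c N).arithmeticSubgroup.subtype) β)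
    {μZ : Measure (borelQuotient F E c N)}
    (hμZ : ∀ f : borelQuotient F E c N → ℝ≥0∞, Measurable f → ∫⁻ z, f z ∂μZ = ∫⁻ g, β g * f (toBorelQuotient F E c N g) ∂νG)
    (k : ℕ) (c₁ : ℝ≥0) [IsFiniteMeasure (weightedTruncMeasure F E c N k c₁ μZ)]
    {φ : (quasiSplit F E c N).Adelic → ℂ} (hφm : Measurable φ) (hφB : ∀ b ∈ ratBorelSubgroup F E c N, ∀ g, φ (b * g) = φ g)
    (hφ2 : MemLp (zFun F E c N φ) 2 (weightedTruncMeasure F E c N k c₁ μZ))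
    (hψ2 : MemLp (zFun F E c N (borelConstantTerm νN 𝓕 φ)) 2 (weightedTruncMeasure F E c N k c₁ μZ))
    (hψc : Continuous (borelConstantTerm νN 𝓕 φ)) :
    toHN F E c N k c₁ μZ φ hφ2 ∈ HNcusp F E c N k c₁ μZ ↔
      zFun F E c N (borelConstantTerm νN 𝓕 φ) =ᵐ[weightedTruncMeasure F E c N k c₁ μZ] 0 :=
  toHN_mem_HNcusp_iff_ae' νN 𝓕 k c₁ μZ h𝓕
    (fun _ hΦm hΦB hint hint' => integral_zFun_borelConstantTerm_eq_of_unfolding νG νN hconj h𝓕 h𝓕₀ h𝓕top hβ hμZ k c₁ hΦm hΦB hint hint')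
    hφm hφB hφ2 hψ2 hψc

/-- **DISCHARGED pointwise form of (iii), `⇐`**: `φ_B = 0` above the height `c` ⟹ `toHN φ ∈ 𝓗_k(Z_c)^cusp`, same letters. [cite: BernsteinLapid2019, §4 Claim 5 p. 10] -/
theorem toHN_mem_HNcusp_of_forall_eq_zero_of_unfolding
    (hconj : ∀ b₀ (hb₀ : b₀ ∈ borelU (c : E →+* E) ((StdForm.antidiagonal N).over E)),
      νN.map (fun v : ↥(adelicUnipotent F E c N) => (⟨((quasiSplit F E c N).toAdelic b₀)⁻¹ * (v : (quasiSplit F E c N).Adelic) * (quasiSplit F E c N).toAdelic b₀,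
        conj_mem_adelicUnipotent ((K2E1PseudoEisensteinConstantTermU.toAdelic_mem_borelAdelic_iff b₀).2 hb₀) v.2⟩ : ↥(adelicUnipotent F E c N))) = νN)
    {𝓕 : Set ↥(adelicUnipotent F E c N)} (h𝓕 : IsFundamentalDomain ↥(rationalUnipotent F E c N) 𝓕 νN) (h𝓕₀ : νN 𝓕 ≠ 0) (h𝓕top : νN 𝓕 ≠ ∞)
    {β : (quasiSplit F E c N).Adelic → ℝ≥0∞} (hβ : IsCoveringWeight ↥((arithmeticBorel F E c N).map (quasiSplit F E c N).arithmeticSubgroup.subtype) β)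
    {μZ : Measure (borelQuotient F E c N)}
    (hμZ : ∀ f : borelQuotient F E c N → ℝ≥0∞, Measurable f → ∫⁻ z, f z ∂μZ = ∫⁻ g, β g * f (toBorelQuotient F E c N g) ∂νG)
    (k : ℕ) (c₁ : ℝ≥0) [IsFiniteMeasure (weightedTruncMeasure F E c N k c₁ μZ)]
    {φ : (quasiSplit F E c N).Adelic → ℂ} (hφm : Measurable φ) (hφB : ∀ b ∈ ratBorelSubgroup F E c N, ∀ g, φ (b * g) = φ g)
    (hφ2 : MemLp (zFun F E c N φ) 2 (weightedTruncMeasure F E c N k c₁ μZ)) (hψc : Continuous (borelConstantTerm νN 𝓕 φ))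
    (h0 : ∀ g, c₁ < borelHeight g → borelConstantTerm νN 𝓕 φ g = 0) :
    toHN F E c N k c₁ μZ φ hφ2 ∈ HNcusp F E c N k c₁ μZ :=
  toHN_mem_HNcusp_of_forall_eq_zero' νN 𝓕 k c₁ μZ h𝓕
    (fun _ hΦm hΦB hint hint' => integral_zFun_borelConstantTerm_eq_of_unfolding νG νN hconj h𝓕 h𝓕₀ h𝓕top hβ hμZ k c₁ hΦm hΦB hint hint')
    hφm hφB hφ2 hψc h0

end Unfolding

end Summit.HodgeConjecture.HodgeConjecture.Cruxes.H413.K2E1BLConstantTermProjectionMeasurableU2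

end
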